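import Literature.MathematicalPhysics.QuantumFieldTheory.BalabanImbrieJaffe1984to88.BIJ88Sect2Statements

/-!
# `BalabanImbrieJaffe1984to88.BIJ88Eq240Existence` — T. Bałaban, J. Imbrie, A. Jaffe, *Effective action and cluster properties of the
abelian Higgs model*, Commun. Math. Phys. **114** (1988) 257–315 [BalabanImbrieJaffe1988]: the content of the definitions **(2.39)**/**(2.40)**,
p. 264 — the single-scale scalar propagator `C^{(k)}_Λ = [(Δ + aL^{−2}Q(u)^*Q(u))|_Λ]^{−1}` EXISTS and is UNIQUE, by the sentence following
(2.41): *"By (2.38), Δ_{k,loc}(u) + aL^{−2}Q(u)^*Q(u) is bounded below"* — PROVED as ring algebra (uniqueness) and on the finite-lattice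
real-matrix model (existence from a strictly positive quadratic form; the lower bound from a (2.38)-shape bound)

statement-level skeleton of published theorems with citation tags; proofs where landed; nothing here is a claim about the Yang–Mills mass gap

PDF held: `paper:balaban1988-cmp114-bij-abelian-higgs-effective-action` (journal page = PDF page + 256); p. 264 [PDF 8] read this session
from the text layer (`lit read … --pages 8`).

WHAT IS REPRODUCED.  SKELETON rows **C2.Eq2.39**, **C2.Eq2.40** (cell `lit-balaban`, HOME `run/shared/lean/pub/lit-balaban/`; Phase-2 seat
p02 gen 3 = unit `lit-balaban-p02`; C2 §§1–4 fold owner r18, referee ref-5; TAKING line HOME/STATUS.md 2026-08-21T05:07:25Z).  Both rows are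
DEFINITIONS, typed p239939 by r18 as the Prop `BIJ88Sect2Statements.Eq240 a L Δ Qst Q C` (*"C is a two-sided inverse of Δ + aL^{−2}Q^*Q"* in
the algebra of operators restricted to Λ).
p. 264, verbatim: *"C^{(k)}_Λ(Ω,u) = [(Δ_k(Ω,u) + aL^{−2}Q(u)^*Q(u))|_Λ]^{−1}, (2.39) the single-scale propagator for the scalar field in the k-th
step. … We define C^{(k)}_Λ(u) = [(Δ_{k,loc}(u) + aL^{−2}Q(u)^*Q(u)|_Λ]^{−1}. (2.40) This operator has good decay properties … (2.41) By (2.38),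
Δ_{k,loc}(u) + aL^{−2}Q(u)^*Q(u) is bounded below, and a random walk expansion as in [6] yields (2.41)"*.

WHAT IS PROVED HERE (0 `sorry`, standard axioms; theorems only).
§1 ANY RING: `eq240_unique` (the propagator, if it exists, is unique), `isUnit_of_eq240` / `eq240_of_isUnit` (`Eq240` ⟺ the restricted operator
is a unit, with `C` its inverse).
§2 FINITE LATTICE Λ (real matrices on the sites of Λ, the ℓ² pairing `⬝ᵥ`; r18's single-algebra typing makes `Q`, `Q^*` square — block fields
read as fields on Λ supported on the block sites): `isUnit_of_pos` — an operator whose quadratic form is strictly positive on `φ ≠ 0` is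
invertible (injective on a finite-dimensional space); `eq240_of_pos` — then `Eq240 a L Δ Q^* Q M⁻¹` for `M = Δ + aL^{−2}Q^*Q` (Mathlib's
`Matrix.nonsing_inv`); `pos_of_lowerBound` — *"bounded below"* (`⟨φ,Mφ⟩ ≥ c₀‖φ‖²`, `c₀ > 0`) gives strict positivity.
§3 THE p. 264 SENTENCE: `lowerBound_of_238` — from a (2.38)-SHAPE lower bound `⟨φ,Δφ⟩ ≥ c·A(φ) − c·e_k²p(e_k)²‖φ‖²` (`A` the covariant Dirichlet
form of (2.38), only `A ≥ 0`-type data), `Q^*` the `⬝ᵥ`-adjoint of `Q`, a Poincaré-type input `c·A(φ) + aL^{−2}‖Qφ‖² ≥ c₁‖φ‖²` (statement input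
of [I] Sect. 7) and smallness `c·e_k²p(e_k)² < c₁`: `⟨φ,(Δ + aL^{−2}Q^*Q)φ⟩ ≥ (c₁ − c·e_k²p(e_k)²)‖φ‖²`; assembled: `eq240_of_238`.
HONEST SCOPE.  (2.38) itself and the Poincaré-type inequality are INPUTS (statement rows); r18's typed (2.38) `Ineq238` lives on the `Setup` tori
with complex site fields — here its SHAPE is the hypothesis `h238` on the real finite-lattice model (real and imaginary parts alike), not an import
of that row; the decay (2.41) is the sibling `BIJ88Decay241Walks`; nothing on d = 4 or the continuum; NOT summit progress.
-/

namespace Literature.MathematicalPhysics.QuantumFieldTheory.BalabanImbrieJaffe1984to88.BIJ88Eq240Existence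

open BIJ88Sect2Statements Matrix

noncomputable section

/-! ## §1  Any ring: uniqueness, and `Eq240` ⟺ unit -/

section Ring

variable {R : Type*} [Ring R] [Algebra ℝ R]

/-- **Uniqueness of the propagator (2.39)/(2.40)**: a two-sided inverse of `Δ + aL^{−2}Q^*Q` in the restricted operator algebra is unique.
[cite: BalabanImbrieJaffe1988, (2.40) p.264] -/
theorem eq240_unique {a L : ℝ} {Δ Qst Q C C' : R} (h : Eq240 a L Δ Qst Q C) (h' : Eq240 a L Δ Qst Q C') : C = C' := by
  calc C = C * ((Δ + algebraMap ℝ R (a * L ^ (-(2 : ℤ))) * (Qst * Q)) * C') := by rw [h'.2, mul_one]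
    _ = C * (Δ + algebraMap ℝ R (a * L ^ (-(2 : ℤ))) * (Qst * Q)) * C' := by rw [mul_assoc]
    _ = C' := by rw [h.1, one_mul]

/-- `Eq240` makes the restricted operator a unit. [cite: BalabanImbrieJaffe1988, (2.40) p.264] -/
theorem isUnit_of_eq240 {a L : ℝ} {Δ Qst Q C : R} (h : Eq240 a L Δ Qst Q C) :
    IsUnit (Δ + algebraMap ℝ R (a * L ^ (-(2 : ℤ))) * (Qst * Q)) :=
  ⟨⟨_, C, h.2, h.1⟩, rfl⟩

/-- Conversely a unit has THE propagator: its inverse satisfies (2.39)/(2.40). [cite: BalabanImbrieJaffe1988, (2.40) p.264] -/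
theorem eq240_of_isUnit {a L : ℝ} {Δ Qst Q : R} (hM : IsUnit (Δ + algebraMap ℝ R (a * L ^ (-(2 : ℤ))) * (Qst * Q))) :
    Eq240 a L Δ Qst Q ↑hM.unit⁻¹ :=
  ⟨hM.val_inv_mul, hM.mul_val_inv⟩

end Ring

/-! ## §2  Finite lattice Λ: existence from a strictly positive form -/

section Lattice

variable {n : Type*} [Fintype n] [DecidableEq n]

omit [DecidableEq n] in
/-- `‖φ‖² = φ ⬝ᵥ φ > 0` for a nonzero real lattice field. [folklore] -/
private theorem dotProduct_self_pos_of_ne_zero {φ : n → ℝ} (hφ : φ ≠ 0) : 0 < φ ⬝ᵥ φ := by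
  have h0 : 0 ≤ φ ⬝ᵥ φ := Finset.sum_nonneg fun i _ => mul_self_nonneg (φ i)
  rcases h0.lt_or_eq with h | h
  · exact h
  · exact absurd (dotProduct_self_eq_zero.1 h.symm) hφ

/-- On the finite lattice Λ an operator whose quadratic form is strictly positive on nonzero fields is invertible (it is injective:
`M φ = M ψ` gives `⟨φ − ψ, M(φ − ψ)⟩ = 0`). [cite: BalabanImbrieJaffe1988, (2.40)–(2.41) p.264] -/
theorem isUnit_of_pos {M : Matrix n n ℝ} (hpos : ∀ φ, φ ≠ 0 → 0 < φ ⬝ᵥ (M *ᵥ φ)) : IsUnit M := by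
  rw [← Matrix.mulVec_injective_iff_isUnit]
  intro φ ψ h
  by_contra hne
  have h1 := hpos (φ - ψ) (sub_ne_zero.2 hne)
  rw [Matrix.mulVec_sub, h, sub_self, dotProduct_zero] at h1
  exact lt_irrefl _ h1

/-- **Existence of the propagator (2.39)/(2.40) on the finite lattice Λ**: if the quadratic form of `M = Δ + aL^{−2}Q^*Q` is strictly positive
on nonzero fields then `C^{(k)}_Λ := M⁻¹` (Mathlib's `Matrix.nonsing_inv`) satisfies `Eq240`. [cite: BalabanImbrieJaffe1988, (2.40) p.264] -/
theorem eq240_of_pos {a L : ℝ} {Δ : Matrix n n ℝ} {Qst Q : Matrix n n ℝ}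
    (hpos : ∀ φ, φ ≠ 0 → 0 < φ ⬝ᵥ ((Δ + algebraMap ℝ (Matrix n n ℝ) (a * L ^ (-(2 : ℤ))) * (Qst * Q)) *ᵥ φ)) :
    Eq240 a L Δ Qst Q (Δ + algebraMap ℝ (Matrix n n ℝ) (a * L ^ (-(2 : ℤ))) * (Qst * Q))⁻¹ := by
  have hdet := (Matrix.isUnit_iff_isUnit_det _).1 (isUnit_of_pos hpos)
  exact ⟨Matrix.nonsing_inv_mul _ hdet, Matrix.mul_nonsing_inv _ hdet⟩

omit [DecidableEq n] in
/-- *"bounded below"* ⟹ strictly positive: `⟨φ,Mφ⟩ ≥ c₀‖φ‖²` with `c₀ > 0`. [cite: BalabanImbrieJaffe1988, (2.41) p.264] -/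
theorem pos_of_lowerBound {M : Matrix n n ℝ} {c₀ : ℝ} (hc₀ : 0 < c₀) (hlow : ∀ φ, c₀ * (φ ⬝ᵥ φ) ≤ φ ⬝ᵥ (M *ᵥ φ)) :
    ∀ φ, φ ≠ 0 → 0 < φ ⬝ᵥ (M *ᵥ φ) := fun φ hφ =>
  lt_of_lt_of_le (mul_pos hc₀ (dotProduct_self_pos_of_ne_zero hφ)) (hlow φ)

end Lattice

/-! ## §3  The p. 264 sentence: bounded below, by (2.38) -/

section LowerBound

variable {n : Type*} [Fintype n] [DecidableEq n]

/-- The quadratic form of `Δ + b·Q^*Q` for the `⬝ᵥ`-adjoint `Q^*` of `Q`: `⟨φ,(Δ + bQ^*Q)φ⟩ = ⟨φ,Δφ⟩ + b‖Qφ‖²`.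
[cite: BalabanImbrieJaffe1988, (2.40) p.264] -/
theorem form_add_smul_adj {Δ : Matrix n n ℝ} {Qst Q : Matrix n n ℝ}
    (hadj : ∀ φ ψ : n → ℝ, φ ⬝ᵥ (Qst *ᵥ ψ) = (Q *ᵥ φ) ⬝ᵥ ψ) (b : ℝ) (φ : n → ℝ) :
    φ ⬝ᵥ ((Δ + algebraMap ℝ (Matrix n n ℝ) b * (Qst * Q)) *ᵥ φ) = φ ⬝ᵥ (Δ *ᵥ φ) + b * ((Q *ᵥ φ) ⬝ᵥ (Q *ᵥ φ)) := by
  rw [Algebra.algebraMap_eq_smul_one, smul_mul_assoc, one_mul, Matrix.add_mulVec, Matrix.smul_mulVec, ← Matrix.mulVec_mulVec,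
    dotProduct_add, dotProduct_smul, hadj, smul_eq_mul]

/-- **"By (2.38), Δ_{k,loc}(u) + aL^{−2}Q(u)^*Q(u) is bounded below"** (p. 264): from a (2.38)-SHAPE lower bound
`⟨φ,Δφ⟩ ≥ c·A(φ) − c·e_k²p(e_k)²‖φ‖²`, a Poincaré-type input `c·A(φ) + aL^{−2}‖Qφ‖² ≥ c₁‖φ‖²` ([I] Sect. 7, statement input) and `Q^*` the
`⬝ᵥ`-adjoint of `Q`: `⟨φ,(Δ + aL^{−2}Q^*Q)φ⟩ ≥ (c₁ − c·e_k²p(e_k)²)‖φ‖²`. [cite: BalabanImbrieJaffe1988, (2.38)/(2.41) p.264] -/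
theorem lowerBound_of_238 {a L c c₁ ek pek : ℝ} {Δ : Matrix n n ℝ} {Qst Q : Matrix n n ℝ} {A : (n → ℝ) → ℝ}
    (hadj : ∀ φ ψ : n → ℝ, φ ⬝ᵥ (Qst *ᵥ ψ) = (Q *ᵥ φ) ⬝ᵥ ψ)
    (h238 : ∀ φ, c * A φ - c * ek ^ 2 * pek ^ 2 * (φ ⬝ᵥ φ) ≤ φ ⬝ᵥ (Δ *ᵥ φ))
    (hP : ∀ φ, c₁ * (φ ⬝ᵥ φ) ≤ c * A φ + a * L ^ (-(2 : ℤ)) * ((Q *ᵥ φ) ⬝ᵥ (Q *ᵥ φ))) (φ : n → ℝ) :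
    (c₁ - c * ek ^ 2 * pek ^ 2) * (φ ⬝ᵥ φ) ≤ φ ⬝ᵥ ((Δ + algebraMap ℝ (Matrix n n ℝ) (a * L ^ (-(2 : ℤ))) * (Qst * Q)) *ᵥ φ) := by
  rw [form_add_smul_adj hadj]
  have h1 := h238 φ
  have h2 := hP φ
  nlinarith

/-- **(2.39)/(2.40) EXIST on the finite lattice Λ, by (2.38)** — assembled: the (2.38)-shape lower bound, the Poincaré-type input and the
smallness `c·e_k²p(e_k)² < c₁` give `Eq240 a L Δ Q^* Q M⁻¹` for `M = Δ + aL^{−2}Q^*Q`, and by `eq240_unique` this is the only propagator.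
[cite: BalabanImbrieJaffe1988, (2.40)–(2.41) p.264] -/
theorem eq240_of_238 {a L c c₁ ek pek : ℝ} {Δ : Matrix n n ℝ} {Qst Q : Matrix n n ℝ} {A : (n → ℝ) → ℝ}
    (hadj : ∀ φ ψ : n → ℝ, φ ⬝ᵥ (Qst *ᵥ ψ) = (Q *ᵥ φ) ⬝ᵥ ψ)
    (h238 : ∀ φ, c * A φ - c * ek ^ 2 * pek ^ 2 * (φ ⬝ᵥ φ) ≤ φ ⬝ᵥ (Δ *ᵥ φ))
    (hP : ∀ φ, c₁ * (φ ⬝ᵥ φ) ≤ c * A φ + a * L ^ (-(2 : ℤ)) * ((Q *ᵥ φ) ⬝ᵥ (Q *ᵥ φ))) (hsmall : c * ek ^ 2 * pek ^ 2 < c₁) :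
    Eq240 a L Δ Qst Q (Δ + algebraMap ℝ (Matrix n n ℝ) (a * L ^ (-(2 : ℤ))) * (Qst * Q))⁻¹ :=
  eq240_of_pos (pos_of_lowerBound (sub_pos.2 hsmall) (lowerBound_of_238 hadj h238 hP))

end LowerBound

end

end Literature.MathematicalPhysics.QuantumFieldTheory.BalabanImbrieJaffe1984to88.BIJ88Eq240Existence
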